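import Literature.AlgebraicGeometry.Frobenioids.UnitTrivializationPullbacks
import Literature.AlgebraicGeometry.Frobenioids.CoAngularPreSteps
import Literature.AlgebraicGeometry.Frobenioids.Composites
import Literature.AlgebraicGeometry.Frobenioids.Birationalization
import HarnessLib

/-!
# Frobenioids I, Proposition 3.3 (iv): `C^un-tr` is a Frobenioid (of isotropic, unit-trivial type)

Mochizuki, *The geometry of Frobenioids I: the general theory*, Kyushu J. Math. **62** (2008)
293–400, Prop. 3.3 (iv) p. 60 ("this functor determines a natural structure of Frobenioid on
`C^un-tr`, with respect to which `C^un-tr` is of isotropic and unit-trivial type"), proof p. 61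
("In light of assertions (ii), (iii), assertion (iv) is immediate from the definitions."); Def. 1.3
pp. 23–25, Prop. 1.11 (vii) p. 37 [cite: MochizukiFrdI2008, Prop. 3.3 (iv) p.60]. Proof-only sequel of
`UnitTrivializationFunctor.lean` / `UnitTrivializationPullbacks.lean` (construction row «`C^un-tr` is a
Frobenioid + `(C^un-tr)^birat`», seat abc-iut-L1-d5; inputs of [FrdI] Prop. 4.8 (iii) (b), seat
abc-iut-L6-t20, and of the Cor. 4.11 (ii) tower, seat abc-iut-L1-d6). For a Frobenioid `F : C → F_Φ`
(found's `IsFrobenioid`), `S = ofFunctor Φ F`, `U = untrFunctor hF : S.Untr ⥤ F_Φ`: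

* `isFrobenioid_untr : IsFrobenioid (untrFunctor hF)` — Def. 1.3 (i)–(vii) for `C^un-tr → F_Φ`, field by
  field: existence clauses are pushed down from `C` (all intermediate objects are isotropic by
  Def. 1.3 (vii)(b) and Prop. 1.9 (iv)); uniqueness clauses use Prop. 3.3 (ii), total epimorphicity
  of `C^un-tr`, that its pre-steps are monomorphisms and that its isometric pre-steps are isomorphisms;
* `hasBiratSquares_untr : HasBiratSquares (untrFunctor hF)` — the squares of Prop. 1.11 (vii) for
  `C^un-tr` (squares of `C`, `exists_coAngular_square`, pushed down), so that the birationalization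
  `Birat (untrFunctor hF) (isFrobenioid_untr hF) (hasBiratSquares_untr hF)` is available.
No statement of the paper is strengthened; nothing here bears on [IUTchIII] Cor. 3.12.
-/

namespace Literature.AlgebraicGeometry.Frobenioids

open CategoryTheory Opposite

universe w v v' u u'

namespace PreFrobenioid

variable {D : Type u} [Category.{v} D] {Φ : Dᵒᵖ ⥤ CommMonCat.{w}} {C : Type u'}
  [Category.{v'} C] {F : C ⥤ ElemFrobenioid Φ}

open PreFrobenioidData (ofFunctor)

/-- An arrow of `C` out of an isotropic object is co-angular (the intermediate objects of a
factorisation are isotropic, Def. 1.3 (vii)(b), so the isometric pre-step is an isomorphism).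
[cite: MochizukiFrdI2008, Def. 1.3 (vii) p.25] -/
theorem isCoAngular_of_isIsotropic_src (hF : IsFrobenioid F) {A B : C} (φ : A ⟶ B)
    (hA : IsIsotropic F A) : IsCoAngular F φ := fun _ _ γ β _ _ _ hβ hβ' _ => (hF.vii_b γ hA) β hβ hβ'

/-- A representative of a co-angular pre-step of `C^un-tr` is a co-angular pre-step of `C`.
[cite: MochizukiFrdI2008, Prop. 3.3 (iv) p.60] -/
theorem isCoAngularPreStep_of_toUntr (hF : IsFrobenioid F) {A B : (ofFunctor Φ F).Istr} (a : A ⟶ B)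
    (h : IsCoAngularPreStep (untrFunctor hF) ((ofFunctor Φ F).toUntr.map a)) :
    IsCoAngularPreStep F a.hom :=
  ⟨isCoAngular_of_isIsotropic_src hF a.hom
    ((PreFrobenioidData.ofFunctor_isIsotropic F A.obj).mp A.property), h.2⟩

/-- The class of a pre-step of `C` (between isotropic objects) is a co-angular pre-step of `C^un-tr`.
[cite: MochizukiFrdI2008, Prop. 3.3 (iv) p.60] -/
theorem isCoAngularPreStep_toUntr_of (hF : IsFrobenioid F) {A B : (ofFunctor Φ F).Istr} (a : A ⟶ B)
    (h : IsPreStep F a.hom) : IsCoAngularPreStep (untrFunctor hF) ((ofFunctor Φ F).toUntr.map a) :=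
  ⟨isCoAngular_untr hF _, h⟩

/-- Isotropy of an object of `C` in the §3–§4 vocabulary. [cite: MochizukiFrdI2008, Def. 1.2 (iv) p.23] -/
theorem isIsotropic_data_of {A : C} (h : IsIsotropic F A) : (ofFunctor Φ F).IsIsotropic A :=
  (PreFrobenioidData.ofFunctor_isIsotropic F A).mpr h

/-! ### `C^un-tr` is a Frobenioid -/

/-- **Prop. 3.3 (iv): `C^un-tr`, with `C^un-tr → F_Φ`, is a Frobenioid** (Def. 1.3 (i)–(vii)).
[cite: MochizukiFrdI2008, Prop. 3.3 (iv) p.60] -/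
theorem isFrobenioid_untr (hF : IsFrobenioid F) : IsFrobenioid (untrFunctor hF) := by
  have hP := hF.isPreFrobenioid
  have hiso : ∀ X : (ofFunctor Φ F).Untr, IsIsotropic F X.as.obj := fun X =>
    (PreFrobenioidData.ofFunctor_isIsotropic F X.as.obj).mp X.as.property
  refine
    { isPreFrobenioid := isPreFrobenioid_untr hF
      i_a := ?_, i_b := ?_, i_c := ?_, ii_exists := ?_, ii_unique := ?_, iii_a := ?_, iii_b := ?_,
      iii_c := ?_, iii_c_base := ?_, iii_d_under_full := ?_, iii_d_under_surj := ?_,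
      iii_d_over_full := ?_, iii_d_over_surj := ?_, iv_a_exists := ?_, iv_a_unique := ?_, iv_b := ?_,
      v_a := ?_, v_b_exists := ?_, v_b_unique := ?_, v_c_exists := ?_, v_c_unique := ?_, vi := ?_,
      vii_a := ?_, vii_b := ?_ }
  · -- (i)(a): the isotropic hull of a Frobenius-trivial object over `A₀`
    intro A₀
    obtain ⟨A, hA, ⟨i⟩⟩ := hF.i_a A₀
    obtain ⟨A₁, h, hh⟩ := hF.vii_a A
    haveI : IsIso (Base F h) := hh.2.1.2
    let A₁' : (ofFunctor Φ F).Istr := ⟨A₁, isIsotropic_data_of hh.2.2.1⟩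
    obtain ⟨ζ, hζ⟩ := isFrobeniusTrivial_hull hF hh hA
    let ι : End A₁ →* End A₁' :=
      { toFun := fun a => ObjectProperty.homMk a, map_one' := rfl, map_mul' := fun _ _ => rfl }
    refine ⟨(ofFunctor Φ F).toUntr.obj A₁', ⟨((ofFunctor Φ F).toUntr.mapEnd A₁').comp (ι.comp ζ),
      fun n => ⟨(hζ n).1, (hζ n).2.1, (isFrobeniusType_toUntr_iff hF _).mpr (hζ n).2.2⟩⟩,
      ⟨(asIso (Base F h)).symm ≪≫ i⟩⟩
  · -- (i)(b): push the common source of the two pre-steps to its isotropic hull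
    intro A B α
    obtain ⟨X, φ, ψ, hφ, hψ, hαφψ⟩ := hF.i_b A.as.obj B.as.obj α
    obtain ⟨X₁, k, hk⟩ := hF.vii_a X
    obtain ⟨φ', hφ', -⟩ := hk.2.2.2 φ (hiso A)
    obtain ⟨ψ', hψ', -⟩ := hk.2.2.2 ψ (hiso B)
    have hφ'p : IsPreStep F φ' := (isPreStep_factors F hP.isTotallyEpimorphic_base
      (show IsPreStep F (k ≫ φ') by rw [hφ']; exact hφ)).1
    have hψ'p : IsPreStep F ψ' := (isPreStep_factors F hP.isTotallyEpimorphic_base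
      (show IsPreStep F (k ≫ ψ') by rw [hψ']; exact hψ)).1
    haveI : IsIso (Base F k) := hk.2.1.2
    let X₁' : (ofFunctor Φ F).Istr := ⟨X₁, isIsotropic_data_of hk.2.2.1⟩
    refine ⟨(ofFunctor Φ F).toUntr.obj X₁',
      (ofFunctor Φ F).toUntr.map (ObjectProperty.homMk φ' : X₁' ⟶ A.as),
      (ofFunctor Φ F).toUntr.map (ObjectProperty.homMk ψ' : X₁' ⟶ B.as), hφ'p, hψ'p, ?_⟩
    change Base F φ' ≫ α.hom = Base F ψ'
    rw [← cancel_epi (Base F k), ← Category.assoc, ← base_comp F, hφ']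
    erw [hαφψ]
    exact (congrArg (Base F) hψ').symm.trans (base_comp F k ψ')
  · -- (i)(c): full and faithful for every pre-Frobenioid; essentially surjective via `C`
    intro A
    haveI := pullbackSliceToBase_faithful (untrFunctor hF) A
    haveI := pullbackSliceToBase_full (untrFunctor hF) A
    refine { faithful := inferInstance, full := inferInstance, essSurj := ⟨fun W => ?_⟩ }
    haveI := hF.i_c A.as.obj
    obtain ⟨P, ⟨e⟩⟩ := Functor.EssSurj.mem_essImage (pullbackSliceToBase F A.as.obj)
      (Over.mk (W.hom : _ ⟶ baseObj F A.as.obj))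
    have hPiso : IsIsotropic F P.left.obj :=
      (isIsotropic_iff_of_isPullbackMorphism hF P.hom.1 P.hom.2).mpr (hiso A)
    let Wc : (ofFunctor Φ F).Istr := ⟨P.left.obj, isIsotropic_data_of hPiso⟩
    let ψ : Wc ⟶ A.as := ObjectProperty.homMk P.hom.1
    have hψ : IsPullbackMorphism (untrFunctor hF) ((ofFunctor Φ F).toUntr.map ψ) :=
      isPullbackMorphism_toUntr_of hF ψ P.hom.2
    let V : Over (⟨A⟩ : PullbackCat (untrFunctor hF)) :=
      Over.mk (Y := ⟨(ofFunctor Φ F).toUntr.obj Wc⟩) ⟨(ofFunctor Φ F).toUntr.map ψ, hψ⟩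
    refine ⟨V, ⟨Over.isoMk ((Over.forget _).mapIso e) ?_⟩⟩
    exact Over.w e.hom
  · -- (ii) existence
    intro A n
    obtain ⟨B, φ, hφ, hn⟩ := hF.ii_exists A.as.obj n
    let B' : (ofFunctor Φ F).Istr := ⟨B, isIsotropic_data_of (hF.vii_b φ (hiso A))⟩
    exact ⟨(ofFunctor Φ F).toUntr.obj B', (ofFunctor Φ F).toUntr.map (ObjectProperty.homMk φ : A.as ⟶ B'),
      (isFrobeniusType_toUntr_iff hF _).mpr hφ, hn⟩
  · -- (ii) uniqueness
    intro A B B' φ ψ hφ hψ hdeg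
    exact exists_iso_of_isFrobeniusType_untr hF φ ψ hφ hψ hdeg
  · -- (iii)(a)
    intro X Y Z f g _ _
    exact isCoAngular_untr hF _
  · -- (iii)(b)
    intro A' A φ _ ψ
    exact isCoAngular_untr hF ψ
  · -- (iii)(c): transport of `O^▷` along a co-angular pre-step, forced by epi/mono cancellation
    intro A B φ hφ
    obtain ⟨f, rfl⟩ := (ofFunctor Φ F).toUntr.map_surjective (X := A.as) (Y := B.as) φ
    have hf : IsCoAngularPreStep F f.hom := isCoAngularPreStep_of_toUntr hF f hφ
    obtain ⟨e₀, he₀⟩ := hF.iii_c f.hom hf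
    haveI hepi := (isTotallyEpimorphic_untr hF).epi ((ofFunctor Φ F).toUntr.map f)
    haveI hmono := mono_of_isPreStep_untr hF ((ofFunctor Φ F).toUntr.map f) hφ.2
    -- existence of an intertwiner for every `u ∈ O^▷(A^un-tr)`
    have hex : ∀ u : endSubmonoid (untrFunctor hF) ((ofFunctor Φ F).toUntr.obj A.as),
        ∃ w : endSubmonoid (untrFunctor hF) ((ofFunctor Φ F).toUntr.obj B.as),
          (ofFunctor Φ F).toUntr.map f ≫ (show _ ⟶ _ from w.1) =
            (show _ ⟶ _ from u.1) ≫ (ofFunctor Φ F).toUntr.map f := by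
      intro u
      obtain ⟨a, ha⟩ := (ofFunctor Φ F).toUntr.map_surjective (X := A.as) (Y := A.as) u.1
      have ha' : a.hom ∈ endSubmonoid F A.as.obj := by
        have hu := u.2
        rw [← ha] at hu
        exact hu
      refine ⟨⟨(ofFunctor Φ F).toUntr.map (ObjectProperty.homMk (e₀ ⟨a.hom, ha'⟩).1), (e₀ ⟨a.hom, ha'⟩).2⟩,
        ?_⟩
      change (ofFunctor Φ F).toUntr.map f ≫ (ofFunctor Φ F).toUntr.map _ =
        (show _ ⟶ _ from u.1) ≫ (ofFunctor Φ F).toUntr.map f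
      rw [← ha, ← Functor.map_comp, ← Functor.map_comp]
      exact congrArg _ (ObjectProperty.hom_ext _ (he₀ ⟨a.hom, ha'⟩))
    -- existence of a preimage for every `w ∈ O^▷(B^un-tr)`
    have hex' : ∀ w : endSubmonoid (untrFunctor hF) ((ofFunctor Φ F).toUntr.obj B.as),
        ∃ u : endSubmonoid (untrFunctor hF) ((ofFunctor Φ F).toUntr.obj A.as),
          (ofFunctor Φ F).toUntr.map f ≫ (show _ ⟶ _ from w.1) =
            (show _ ⟶ _ from u.1) ≫ (ofFunctor Φ F).toUntr.map f := by
      intro w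
      obtain ⟨b, hb⟩ := (ofFunctor Φ F).toUntr.map_surjective (X := B.as) (Y := B.as) w.1
      have hb' : b.hom ∈ endSubmonoid F B.as.obj := by
        have hw := w.2
        rw [← hb] at hw
        exact hw
      refine ⟨⟨(ofFunctor Φ F).toUntr.map (ObjectProperty.homMk (e₀.symm ⟨b.hom, hb'⟩).1),
        (e₀.symm ⟨b.hom, hb'⟩).2⟩, ?_⟩
      change (ofFunctor Φ F).toUntr.map f ≫ (show _ ⟶ _ from w.1) =
        (ofFunctor Φ F).toUntr.map _ ≫ (ofFunctor Φ F).toUntr.map f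
      rw [← hb, ← Functor.map_comp, ← Functor.map_comp]
      refine congrArg _ (ObjectProperty.hom_ext _ ?_)
      have := he₀ (e₀.symm ⟨b.hom, hb'⟩)
      rw [MulEquiv.apply_symm_apply] at this
      change f.hom ≫ b.hom = (e₀.symm ⟨b.hom, hb'⟩).1 ≫ f.hom
      simpa using this
    -- uniqueness of the intertwiner (total epimorphicity)
    have huniq : ∀ (u : endSubmonoid (untrFunctor hF) ((ofFunctor Φ F).toUntr.obj A.as))
        (w w' : endSubmonoid (untrFunctor hF) ((ofFunctor Φ F).toUntr.obj B.as)),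
        (ofFunctor Φ F).toUntr.map f ≫ (show _ ⟶ _ from w.1) =
            (show _ ⟶ _ from u.1) ≫ (ofFunctor Φ F).toUntr.map f →
        (ofFunctor Φ F).toUntr.map f ≫ (show _ ⟶ _ from w'.1) =
            (show _ ⟶ _ from u.1) ≫ (ofFunctor Φ F).toUntr.map f → w = w' := by
      intro u w w' h h'
      apply Subtype.ext
      exact (cancel_epi ((ofFunctor Φ F).toUntr.map f)).mp (h.trans h'.symm)
    let g : endSubmonoid (untrFunctor hF) ((ofFunctor Φ F).toUntr.obj A.as) →*
        endSubmonoid (untrFunctor hF) ((ofFunctor Φ F).toUntr.obj B.as) :=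
      { toFun := fun u => Classical.choose (hex u)
        map_one' := by
          apply huniq 1 _ 1 (Classical.choose_spec (hex 1))
          change (ofFunctor Φ F).toUntr.map f ≫ 𝟙 _ = 𝟙 _ ≫ (ofFunctor Φ F).toUntr.map f
          rw [Category.comp_id, Category.id_comp]
        map_mul' := fun u v => by
          apply huniq (u * v) _ _ (Classical.choose_spec (hex (u * v)))
          have hu := Classical.choose_spec (hex u)
          have hv := Classical.choose_spec (hex v)
          change (ofFunctor Φ F).toUntr.map f ≫ ((show _ ⟶ _ from (Classical.choose (hex v)).1) ≫
              (show _ ⟶ _ from (Classical.choose (hex u)).1)) =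
            ((show _ ⟶ _ from v.1) ≫ (show _ ⟶ _ from u.1)) ≫ (ofFunctor Φ F).toUntr.map f
          rw [← Category.assoc, hv, Category.assoc, hu, Category.assoc] }
    have hg : ∀ u, (ofFunctor Φ F).toUntr.map f ≫ (show _ ⟶ _ from (g u).1) =
        (show _ ⟶ _ from u.1) ≫ (ofFunctor Φ F).toUntr.map f := fun u => Classical.choose_spec (hex u)
    have hbij : Function.Bijective g := by
      constructor
      · intro u v huv
        have h1 := hg u
        have h2 := hg v
        rw [huv] at h1
        apply Subtype.ext
        exact (cancel_mono ((ofFunctor Φ F).toUntr.map f)).mp (h1.symm.trans h2)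
      · intro w
        obtain ⟨u, hu⟩ := hex' w
        exact ⟨u, huniq u _ _ (hg u) hu⟩
    exact ⟨MulEquiv.ofBijective g hbij, fun u => hg u⟩
  · -- (iii)(c), dependence on `Base(φ)` only: compare with the intertwiners of `C`
    intro A B φ φ' hφ hφ' hb α β β' h h'
    obtain ⟨f, rfl⟩ := (ofFunctor Φ F).toUntr.map_surjective (X := A.as) (Y := B.as) φ
    obtain ⟨f', rfl⟩ := (ofFunctor Φ F).toUntr.map_surjective (X := A.as) (Y := B.as) φ'
    obtain ⟨a, ha⟩ := (ofFunctor Φ F).toUntr.map_surjective (X := A.as) (Y := A.as) α.1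
    obtain ⟨b, hbb⟩ := (ofFunctor Φ F).toUntr.map_surjective (X := B.as) (Y := B.as) β.1
    obtain ⟨b', hbb'⟩ := (ofFunctor Φ F).toUntr.map_surjective (X := B.as) (Y := B.as) β'.1
    have hf : IsCoAngularPreStep F f.hom := isCoAngularPreStep_of_toUntr hF f hφ
    have hf' : IsCoAngularPreStep F f'.hom := isCoAngularPreStep_of_toUntr hF f' hφ'
    have ha' : a.hom ∈ endSubmonoid F A.as.obj := by
      have := α.2; rw [← ha] at this; exact this
    obtain ⟨e₀, he₀⟩ := hF.iii_c f.hom hf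
    obtain ⟨e₀', he₀'⟩ := hF.iii_c f'.hom hf'
    -- the on-the-nose intertwiners of `C`
    let b₁ := e₀ ⟨a.hom, ha'⟩
    let b₁' := e₀' ⟨a.hom, ha'⟩
    have hb₁ : b₁ = b₁' := hF.iii_c_base f.hom f'.hom hf hf' hb ⟨a.hom, ha'⟩ b₁ b₁' (he₀ _) (he₀' _)
    haveI := (isTotallyEpimorphic_untr hF).epi ((ofFunctor Φ F).toUntr.map f)
    haveI := (isTotallyEpimorphic_untr hF).epi ((ofFunctor Φ F).toUntr.map f')
    -- `β = [b₁]`, `β' = [b₁']`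
    have X₁ : (ofFunctor Φ F).toUntr.map f ≫ (ofFunctor Φ F).toUntr.map (ObjectProperty.homMk b₁.1) =
        (ofFunctor Φ F).toUntr.map a ≫ (ofFunctor Φ F).toUntr.map f := by
      rw [← Functor.map_comp, ← Functor.map_comp]
      exact congrArg _ (ObjectProperty.hom_ext _ (he₀ ⟨a.hom, ha'⟩))
    have X₂ : (ofFunctor Φ F).toUntr.map f' ≫ (ofFunctor Φ F).toUntr.map (ObjectProperty.homMk b₁'.1) =
        (ofFunctor Φ F).toUntr.map a ≫ (ofFunctor Φ F).toUntr.map f' := by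
      rw [← Functor.map_comp, ← Functor.map_comp]
      exact congrArg _ (ObjectProperty.hom_ext _ (he₀' ⟨a.hom, ha'⟩))
    rw [ha] at X₁ X₂
    have e1 : (show _ ⟶ _ from β.1) = (ofFunctor Φ F).toUntr.map (ObjectProperty.homMk b₁.1) :=
      (cancel_epi ((ofFunctor Φ F).toUntr.map f)).mp (h.trans X₁.symm)
    have e2 : (show _ ⟶ _ from β'.1) = (ofFunctor Φ F).toUntr.map (ObjectProperty.homMk b₁'.1) :=
      (cancel_epi ((ofFunctor Φ F).toUntr.map f')).mp (h'.trans X₂.symm)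
    apply Subtype.ext
    change (show _ ⟶ _ from β.1) = (show _ ⟶ _ from β'.1)
    rw [e1, e2, hb₁]
  · -- (iii)(d) coslice, full
    intro A B B' φ φ' hφ hφ' hdvd
    obtain ⟨a, rfl⟩ := (ofFunctor Φ F).toUntr.map_surjective (X := A.as) (Y := B.as) φ
    obtain ⟨a', rfl⟩ := (ofFunctor Φ F).toUntr.map_surjective (X := A.as) (Y := B'.as) φ'
    obtain ⟨f₀, hf₀, hcomp⟩ := hF.iii_d_under_full a.hom a'.hom (isCoAngularPreStep_of_toUntr hF a hφ)
      (isCoAngularPreStep_of_toUntr hF a' hφ') hdvd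
    refine ⟨(ofFunctor Φ F).toUntr.map (ObjectProperty.homMk f₀ : B.as ⟶ B'.as),
      isCoAngularPreStep_toUntr_of hF _ hf₀.2, ?_⟩
    change (ofFunctor Φ F).toUntr.map a ≫ (ofFunctor Φ F).toUntr.map (ObjectProperty.homMk f₀ : B.as ⟶ B'.as) =
      (ofFunctor Φ F).toUntr.map a'
    rw [← Functor.map_comp]
    exact congrArg _ (ObjectProperty.hom_ext _ hcomp)
  · -- (iii)(d) coslice, essentially surjective
    intro A x
    obtain ⟨B, φ, hφ, hx⟩ := hF.iii_d_under_surj A.as.obj x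
    let B' : (ofFunctor Φ F).Istr := ⟨B, isIsotropic_data_of (hF.vii_b φ (hiso A))⟩
    exact ⟨(ofFunctor Φ F).toUntr.obj B', (ofFunctor Φ F).toUntr.map (ObjectProperty.homMk φ : A.as ⟶ B'),
      isCoAngularPreStep_toUntr_of hF _ hφ.2, hx⟩
  · -- (iii)(d) slice, full
    intro A B B' ψ ψ' hψ hψ' hdvd
    obtain ⟨b, rfl⟩ := (ofFunctor Φ F).toUntr.map_surjective (X := B.as) (Y := A.as) ψ
    obtain ⟨b', rfl⟩ := (ofFunctor Φ F).toUntr.map_surjective (X := B'.as) (Y := A.as) ψ'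
    obtain ⟨g₀, hg₀, hcomp⟩ := hF.iii_d_over_full b.hom b'.hom (isCoAngularPreStep_of_toUntr hF b hψ)
      (isCoAngularPreStep_of_toUntr hF b' hψ') hdvd
    refine ⟨(ofFunctor Φ F).toUntr.map (ObjectProperty.homMk g₀ : B.as ⟶ B'.as),
      isCoAngularPreStep_toUntr_of hF _ hg₀.2, ?_⟩
    change (ofFunctor Φ F).toUntr.map (ObjectProperty.homMk g₀ : B.as ⟶ B'.as) ≫ (ofFunctor Φ F).toUntr.map b' =
      (ofFunctor Φ F).toUntr.map b
    rw [← Functor.map_comp]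
    exact congrArg _ (ObjectProperty.hom_ext _ hcomp)
  · -- (iii)(d) slice, essentially surjective
    intro A x
    obtain ⟨B, ψ, hψ, hx⟩ := hF.iii_d_over_surj A.as.obj x
    have hB : IsIsotropic F B := (isIsotropic_iff_of_isCoAngular_isLinear hF ψ hψ.1 hψ.2.1).mpr (hiso A)
    let B' : (ofFunctor Φ F).Istr := ⟨B, isIsotropic_data_of hB⟩
    exact ⟨(ofFunctor Φ F).toUntr.obj B', (ofFunctor Φ F).toUntr.map (ObjectProperty.homMk ψ : B' ⟶ A.as),
      isCoAngularPreStep_toUntr_of hF _ hψ.2, hx⟩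
  · -- (iv)(a) existence
    intro A B φ
    obtain ⟨f, rfl⟩ := (ofFunctor Φ F).toUntr.map_surjective (X := A.as) (Y := B.as) φ
    obtain ⟨X₀, Y₀, γ, β, α, hfac, hγ, hβ, hα⟩ := hF.iv_a_exists f.hom
    let X' : (ofFunctor Φ F).Istr := ⟨X₀, isIsotropic_data_of (hF.vii_b γ (hiso A))⟩
    let Y' : (ofFunctor Φ F).Istr := ⟨Y₀, isIsotropic_data_of (hF.vii_b (γ ≫ β) (hiso A))⟩
    refine ⟨(ofFunctor Φ F).toUntr.obj X', (ofFunctor Φ F).toUntr.obj Y',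
      (ofFunctor Φ F).toUntr.map (ObjectProperty.homMk γ : A.as ⟶ X'),
      (ofFunctor Φ F).toUntr.map (ObjectProperty.homMk β : X' ⟶ Y'),
      (ofFunctor Φ F).toUntr.map (ObjectProperty.homMk α : Y' ⟶ B.as), ?_,
      (isFrobeniusType_toUntr_iff hF _).mpr hγ, hβ,
      isPullbackMorphism_toUntr_of hF (ObjectProperty.homMk α : Y' ⟶ B.as) hα⟩
    change (ofFunctor Φ F).toUntr.map (ObjectProperty.homMk γ : A.as ⟶ X') ≫
        (ofFunctor Φ F).toUntr.map (ObjectProperty.homMk β : X' ⟶ Y') ≫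
          (ofFunctor Φ F).toUntr.map (ObjectProperty.homMk α : Y' ⟶ B.as) = (ofFunctor Φ F).toUntr.map f
    rw [← Functor.map_comp, ← Functor.map_comp]
    exact congrArg _ (ObjectProperty.hom_ext _ hfac)
  · -- (iv)(a) uniqueness
    intro A B X Y X' Y' φ γ β α γ' β' α' h hγ hβ hα h' hγ' hβ' hα'
    exact factorisation_unique_untr hF φ γ β α γ' β' α' h hγ hβ hα h' hγ' hβ' hα'
  · -- (iv)(b)
    intro A B α hα
    exact isLBInvertible_isLinear_of_isPullback_untr hF α hα
  · -- (v)(a)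
    intro A B φ hφ
    exact mono_of_isPreStep_untr hF φ hφ
  · -- (v)(b) existence: `φ = φ ≫ id`
    intro A B φ hφ
    exact ⟨B, φ, 𝟙 B, Category.comp_id φ, ⟨isCoAngular_untr hF _, hφ⟩, div_id (untrFunctor hF) B,
      isPreStep_of_isIso (untrFunctor hF) (𝟙 B)⟩
  · -- (v)(b) uniqueness: the isometric pre-steps are isomorphisms
    intro A B X X' φ β α β' α' h _ hα h' _ hα'
    haveI := isIso_of_isIsometry_of_isPreStep_untr hF α hα.1 hα.2
    haveI := isIso_of_isIsometry_of_isPreStep_untr hF α' hα'.1 hα'.2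
    refine ⟨asIso α ≪≫ (asIso α').symm, ?_, ?_⟩
    · change β ≫ α ≫ inv α' = β'
      rw [← Category.assoc, h, ← h', Category.assoc, IsIso.hom_inv_id, Category.comp_id]
    · change α = (α ≫ inv α') ≫ α'
      rw [Category.assoc, IsIso.inv_hom_id, Category.comp_id]
  · -- (v)(c) existence: `φ = id ≫ φ`
    intro A B φ hφ
    exact ⟨A, 𝟙 A, φ, Category.id_comp φ, ⟨div_id (untrFunctor hF) A, isPreStep_of_isIso (untrFunctor hF) (𝟙 A)⟩,
      ⟨isCoAngular_untr hF _, hφ⟩⟩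
  · -- (v)(c) uniqueness
    intro A B X X' φ β α β' α' h hβ _ h' hβ' _
    haveI := isIso_of_isIsometry_of_isPreStep_untr hF β hβ.1 hβ.2
    haveI := isIso_of_isIsometry_of_isPreStep_untr hF β' hβ'.1 hβ'.2
    refine ⟨(asIso β).symm ≪≫ asIso β', ?_, ?_⟩
    · change β ≫ inv β ≫ β' = β'
      rw [IsIso.hom_inv_id_assoc]
    · change α = (inv β ≫ β') ≫ α'
      rw [Category.assoc, h', ← h, IsIso.inv_hom_id_assoc]
  · -- (vi): base-equivalent, metrically equivalent co-angular pre-steps coincide in `C^un-tr`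
    intro A B φ ψ hφ hψ hb hm
    obtain ⟨a, rfl⟩ := (ofFunctor Φ F).toUntr.map_surjective (X := A.as) (Y := B.as) φ
    obtain ⟨b, rfl⟩ := (ofFunctor Φ F).toUntr.map_surjective (X := A.as) (Y := B.as) ψ
    refine ⟨1, Subgroup.one_mem _, ?_⟩
    change (ofFunctor Φ F).toUntr.map b ≫ 𝟙 _ = (ofFunctor Φ F).toUntr.map a
    rw [Category.comp_id]
    refine (toUntr_map_eq_iff hF b a).mpr (ElemFrobenioid.Hom.ext ?_ ?_ ?_)
    · exact Eq.symm hb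
    · exact Eq.symm hm
    · exact (show degFr F b.hom = 1 from hψ.2.1).trans (show degFr F a.hom = 1 from hφ.2.1).symm
  · -- (vii)(a): identities are isotropic hulls
    intro A
    refine ⟨A, 𝟙 A, div_id (untrFunctor hF) A, isPreStep_of_isIso (untrFunctor hF) (𝟙 A),
      isOfIsotropicType_untr hF A, fun X γ _ => ⟨γ, Category.id_comp γ, fun β hβ => ?_⟩⟩
    rw [← hβ, Category.id_comp]
  · -- (vii)(b)
    intro A B _ _
    exact isOfIsotropicType_untr hF B

/-! ### Prop. 1.11 (vii) squares in `C^un-tr` -/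

/-- The square-completion property of Prop. 1.11 (vii) for `C^un-tr` (push down the squares of `C`;
the apex is isotropic by Prop. 1.9 (iv)), i.e. the hypothesis of the birationalization `(C^un-tr)^birat`.
[cite: MochizukiFrdI2008, Prop. 1.11 (vii) p.37] -/
theorem hasBiratSquares_untr (hF : IsFrobenioid F) : HasBiratSquares (untrFunctor hF) := by
  intro X B B' φ β hβ
  obtain ⟨f, rfl⟩ := (ofFunctor Φ F).toUntr.map_surjective (X := X.as) (Y := B.as) φ
  obtain ⟨b, rfl⟩ := (ofFunctor Φ F).toUntr.map_surjective (X := B'.as) (Y := B.as) β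
  have hb : IsCoAngularPreStep F b.hom := isCoAngularPreStep_of_toUntr hF b hβ
  obtain ⟨W, γ, α₀, hγ, hsq⟩ := exists_coAngular_square hF b.hom hb f.hom
  have hX : IsIsotropic F X.as.obj := (PreFrobenioidData.ofFunctor_isIsotropic F X.as.obj).mp X.as.property
  have hW : IsIsotropic F W := (isIsotropic_iff_of_isCoAngular_isLinear hF γ hγ.1 hγ.2.1).mpr hX
  let W' : (ofFunctor Φ F).Istr := ⟨W, isIsotropic_data_of hW⟩
  refine ⟨(ofFunctor Φ F).toUntr.obj W', (ofFunctor Φ F).toUntr.map (ObjectProperty.homMk γ : W' ⟶ X.as),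
    (ofFunctor Φ F).toUntr.map (ObjectProperty.homMk α₀ : W' ⟶ B'.as),
    isCoAngularPreStep_toUntr_of hF _ hγ.2, ?_⟩
  change (ofFunctor Φ F).toUntr.map (ObjectProperty.homMk γ : W' ⟶ X.as) ≫ (ofFunctor Φ F).toUntr.map f =
    (ofFunctor Φ F).toUntr.map (ObjectProperty.homMk α₀ : W' ⟶ B'.as) ≫ (ofFunctor Φ F).toUntr.map b
  rw [← Functor.map_comp, ← Functor.map_comp]
  exact congrArg _ (ObjectProperty.hom_ext _ hsq)

end PreFrobenioid

end Literature.AlgebraicGeometry.Frobenioids
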